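import Summits.Parity.GeneralizedHardyLittlewood.Theorems.FordMaynardSieveConst01651SieveConst01651CertTable
import Summits.Parity.GeneralizedHardyLittlewood.Theorems.FordMaynardSieveConst01651SieveConst01651SignClauseAssembly
import HarnessLib

/-!
# Route `FordMaynardSieveConst01651`, target `SieveConst01651` (stmt-Parity-19185), stub `stub_coneCertClosed`:
# the witness `coneCert` (cone data built from the certified LP table) and its cheap conjuncts

This file DEFINES the intended witness `g₀ = coneCert` of `stub_coneCertClosed` from the tree data
`…SieveConst01651CertTable` (Ford–Maynard, arXiv:2407.14368, Theorem 7.3 (a) at `P = (1/2, 0, 0.1651)`), following the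
certifier fm27_cert_lp.py of the programme (parity-ideate-p3):

* `coneCert = gTab + gFace` (pointwise sum, the shape consumed by `…SignClauseFaces`);
* `gTab` — the table part: `gTab 0 = 1`; `gTab 1 = −1` on `(ν₀, 1/2]` (the table's `g₁ ≡ −1`, written cell-free);
  `gTab 2 (y,z)`, `y ≤ z`, both coordinates in OPEN small cells, `y + z` in an OPEN band (`≠ c₀`, `< 1/2`) = the table
  entry of `(cellIdx y, cellIdx z, bandIdx (y+z))` (`0` if absent); `gTab 3` likewise on monotone triples with all
  coordinates in open small cells and `|y| < 1/2`; `gTab r = 0` for `r ≥ 4`;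
* `gFace` — the face penalty `−64 × (number of face conditions met)` on the closed support region (`monotone`,
  `yᵢ > ν₀`, `|y| ≤ 1/2`, `1 ≤ r ≤ 3`): coordinates on a cell edge `e_a`, pair sums on a band line (`c₀` or `1/2`),
  (`r = 3`) `|y| = 1/2` — a COUNT, so that `gFace` is literally a finite sum of (degenerate) polytope indicators.

PROVED here (cheap conjuncts and the table facts in the shape of `…SignClauseAssembly.signClause_01651_of_parts`):
`coneCert_empty` (conjunct (ii)), `coneCert_support` (conjunct (iii), closed support), `coneCert_one_le`
(`g₁ ≤ −1` on `(ν₀, 1/2]`), `coneCert_two_le_one`, `coneCert_two_corner_le` (`≤ −0.307737` on `(ν₀, 1−5ν₀)²`),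
`coneCert_three_le`, `coneCert_three_half`, and the assembled `coneCert_signClause_of_four_five`: conjunct (iv) for
`coneCert` ⟸ its `k = 4` and `k = 5` instances.  NOT here: conjunct (i) (`IsPiecewiseConstOnCone coneCert` — polytope
bookkeeping over `cellIdx`), the `k = 4, 5` type check, conjunct (v) (numerics).

References: [FordMaynard2024PrimeSieves] arXiv:2407.14368, Definitions 7.1–7.2, Theorem 7.3 (a), §8.2.
-/

noncomputable section

open Finset
open scoped Classical
open Literature.NumberTheory.Sieve Literature.NumberTheory.Sieve.FordMaynard

namespace Summit.Parity.GeneralizedHardyLittlewood.FordMaynardSieveConst01651SieveConst01651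

/-! ### Grid functions on `ℝ` -/

/-- The set of grid edges `e_0, …, e_85` (`certEdge`, cast to `ℝ`). [folklore] -/
def edgeSet : Set ℝ := {t | ∃ a : ℕ, a ≤ 85 ∧ t = ((certEdge a : ℚ) : ℝ)}

/-- The union of the OPEN small cells: `ν₀ < t < 1/2` and `t` is not a grid edge. [folklore] -/
def openSmall : Set ℝ := {t | (1651 / 10000 : ℝ) < t ∧ t < 1 / 2 ∧ t ∉ edgeSet}

/-- The cell index of `t`: `⌊(t − ν₀)/w₁⌋` on `(ν₀, 1/2 − ν₀)` (`w₁ = 283/120000`), `72 + ⌊(t − (1/2 − ν₀))/w₂⌋` on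
`[1/2 − ν₀, 1/2)` (`w₂ = 1651/120000`), and `84` (the big cell) from `1/2` on. [folklore] -/
def cellIdx (t : ℝ) : ℕ :=
  if t < 1 / 2 - 1651 / 10000 then ⌊(t - 1651 / 10000) / (283 / 120000 : ℝ)⌋₊
  else if t < 1 / 2 then 72 + ⌊(t - (1 / 2 - 1651 / 10000)) / (1651 / 120000 : ℝ)⌋₊
  else 84

/-- The pair-sum band index: `0` below the cut `c₀ = 8349/20000`, `1` above. [folklore] -/
def bandIdx (s : ℝ) : ℕ := if s < 8349 / 20000 then 0 else 1

/-- Table lookup for `g₂`: the value (integer, `/10⁶`) of the entry `(a, b, j, ·)` of `certG2`, `0` if absent. [folklore] -/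
def g2Lookup (a b j : ℕ) : ℤ :=
  match certG2.find? (fun e => e.1 == a && e.2.1 == b && e.2.2.1 == j) with
  | some e => e.2.2.2
  | none => 0

/-- Table lookup for `g₃` (two entries: `(0,0,0) ↦ 876398`, `(0,0,1) ↦ 941613`, `/10⁶`). [folklore] -/
def g3Lookup (a b c : ℕ) : ℤ :=
  if a = 0 ∧ b = 0 ∧ c = 0 then 876398 else if a = 0 ∧ b = 0 ∧ c = 1 then 941613 else 0

/-! ### The witness -/

/-- The TABLE part of the witness (values on open pieces; see the module docstring). [folklore] -/
def gTab : VecFn := fun r =>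
  match r with
  | 0 => fun _ => 1
  | 1 => fun y => if (1651 / 10000 : ℝ) < y 0 ∧ y 0 ≤ 1 / 2 then -1 else 0
  | 2 => fun y =>
      if y 0 ≤ y 1 ∧ y 0 ∈ openSmall ∧ y 1 ∈ openSmall ∧ y 0 + y 1 ≠ 8349 / 20000 ∧ y 0 + y 1 < 1 / 2 then
        (g2Lookup (cellIdx (y 0)) (cellIdx (y 1)) (bandIdx (y 0 + y 1)) : ℝ) / 1000000
      else 0
  | 3 => fun y =>
      if Monotone y ∧ (∀ i, y i ∈ openSmall) ∧ ∑ i, y i < 1 / 2 then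
        (g3Lookup (cellIdx (y 0)) (cellIdx (y 1)) (cellIdx (y 2)) : ℝ) / 1000000
      else 0
  | _ + 4 => fun _ => 0

/-- The number of FACE CONDITIONS met by `y` in dimension `r`: coordinates on a grid edge, pairs `i < j` with
`yᵢ + yⱼ` on the band line `c₀`, pairs with `yᵢ + yⱼ = 1/2`, and (in dimension `3`) `|y| = 1/2`.  (A count rather than
an indicator of the union, so that `gFace` is literally a finite sum of polytope indicators.) [folklore] -/
def faceCount (r : ℕ) (y : Fin r → ℝ) : ℕ :=
  (Finset.univ.filter (fun i : Fin r => y i ∈ edgeSet)).card +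
    (Finset.univ.filter (fun q : Fin r × Fin r => q.1 < q.2 ∧ y q.1 + y q.2 = 8349 / 20000)).card +
    (Finset.univ.filter (fun q : Fin r × Fin r => q.1 < q.2 ∧ y q.1 + y q.2 = 1 / 2)).card +
    (if r = 3 ∧ ∑ i, y i = 1 / 2 then 1 else 0)

/-- The FACE part of the witness: `−64 × (number of face conditions met)` on the closed support region
(`1 ≤ r ≤ 3`, `y` monotone, `yᵢ > ν₀`, `|y| ≤ 1/2`), `0` elsewhere — the certifier's `−M`, `M = 64 ≥ 2⁶ · max|g|`, counted
with multiplicity. [folklore] -/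
def gFace : VecFn := fun r y =>
  if 1 ≤ r ∧ r ≤ 3 ∧ Monotone y ∧ (∀ i, (1651 / 10000 : ℝ) < y i) ∧ ∑ i, y i ≤ 1 / 2 then
    -64 * (faceCount r y : ℝ) else 0

/-- **The witness** `g₀ = gTab + gFace` for `stub_coneCertClosed`. [folklore] -/
def coneCert : VecFn := fun r y => gTab r y + gFace r y

/-! ### Lookup facts from the decidable table facts -/

/-- Every `g₂` lookup is `≤ 999999`. [folklore] -/
theorem g2Lookup_le (a b j : ℕ) : g2Lookup a b j ≤ 999999 := by
  unfold g2Lookup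
  split
  · rename_i e he
    have hmem := List.mem_of_find?_eq_some he
    have hall := certG2_all_le
    rw [List.all_eq_true] at hall
    have := hall e hmem
    simpa using this
  · norm_num

/-- On the corner `a ≤ b ≤ 3`, band `0`, the lookup is `≤ −307737`. [folklore] -/
theorem g2Lookup_corner_le : ∀ a, a ≤ 3 → ∀ b, b ≤ 3 → a ≤ b → g2Lookup a b 0 ≤ -307737 := by
  decide +kernel

/-- Every `g₃` lookup is `≤ 941613`. [folklore] -/
theorem g3Lookup_le (a b c : ℕ) : g3Lookup a b c ≤ 941613 := by
  unfold g3Lookup; split_ifs <;> norm_num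

/-! ### Elementary properties of the parts -/

/-- `gFace ≤ 0`. [folklore] -/
theorem gFace_nonpos (r : ℕ) (y : Fin r → ℝ) : gFace r y ≤ 0 := by
  unfold gFace
  split_ifs
  · have : (0 : ℝ) ≤ (faceCount r y : ℝ) := by positivity
    nlinarith
  · norm_num

/-- `gFace ≠ 0 ⇒ gFace ≤ −64` (at least one face condition is met). [folklore] -/
theorem gFace_le_of_ne_zero {r : ℕ} {y : Fin r → ℝ} (h : gFace r y ≠ 0) : gFace r y ≤ -64 := by
  unfold gFace at h ⊢
  split_ifs at h ⊢
  · have hc : faceCount r y ≠ 0 := by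
      intro h0; apply h; rw [h0]; simp
    have h1 : (1 : ℝ) ≤ (faceCount r y : ℝ) := by exact_mod_cast Nat.one_le_iff_ne_zero.2 hc
    nlinarith
  · exact absurd rfl h

/-- On the closed support region, one coordinate on a grid edge already gives `gFace ≤ −64`. [folklore] -/
theorem gFace_le_of_edge {r : ℕ} {y : Fin r → ℝ} (hr : 1 ≤ r) (hr3 : r ≤ 3) (hy : Monotone y)
    (hbox : ∀ i, (1651 / 10000 : ℝ) < y i) (hsum : ∑ i, y i ≤ 1 / 2) (hedge : ∃ i, y i ∈ edgeSet) :
    gFace r y ≤ -64 := by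
  unfold gFace
  rw [if_pos ⟨hr, hr3, hy, hbox, hsum⟩]
  obtain ⟨i, hi⟩ := hedge
  have h1 : 1 ≤ faceCount r y := by
    unfold faceCount
    have : 1 ≤ (Finset.univ.filter (fun i : Fin r => y i ∈ edgeSet)).card :=
      Finset.card_pos.2 ⟨i, Finset.mem_filter.2 ⟨Finset.mem_univ _, hi⟩⟩
    omega
  have h1' : (1 : ℝ) ≤ (faceCount r y : ℝ) := by exact_mod_cast h1
  nlinarith

/-- `gTab 2 ≤ 0.999999`. [folklore] -/
theorem gTab_two_le (y : Fin 2 → ℝ) : gTab 2 y ≤ 999999 / 1000000 := by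
  show (if _ then _ else _ : ℝ) ≤ _
  split_ifs
  · have h := g2Lookup_le (cellIdx (y 0)) (cellIdx (y 1)) (bandIdx (y 0 + y 1))
    have h' : (g2Lookup (cellIdx (y 0)) (cellIdx (y 1)) (bandIdx (y 0 + y 1)) : ℝ) ≤ 999999 := by exact_mod_cast h
    exact div_le_div_of_nonneg_right h' (by norm_num)
  · norm_num

/-- `gTab 3 ≤ 0.941613`. [folklore] -/
theorem gTab_three_le (y : Fin 3 → ℝ) : gTab 3 y ≤ 941613 / 1000000 := by
  show (if _ then _ else _ : ℝ) ≤ _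
  split_ifs
  · have h := g3Lookup_le (cellIdx (y 0)) (cellIdx (y 1)) (cellIdx (y 2))
    have h' : (g3Lookup (cellIdx (y 0)) (cellIdx (y 1)) (cellIdx (y 2)) : ℝ) ≤ 941613 := by exact_mod_cast h
    exact div_le_div_of_nonneg_right h' (by norm_num)
  · norm_num

/-- In the corner `ν₀ < t < 1 − 5ν₀` the cell index is `≤ 3` (`1 − 5ν₀ = 0.1745 < e₄`). [folklore] -/
theorem cellIdx_le_three {t : ℝ} (ht : (1651 / 10000 : ℝ) < t) (ht' : t < 1 - 5 * (1651 / 10000 : ℝ)) :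
    cellIdx t ≤ 3 := by
  unfold cellIdx
  rw [if_pos (by linarith)]
  have h4 : (t - 1651 / 10000) / (283 / 120000 : ℝ) < 4 := by
    rw [div_lt_iff₀ (by norm_num)]; linarith
  have := Nat.floor_lt (n := 4) (by apply div_nonneg <;> linarith : (0 : ℝ) ≤ (t - 1651 / 10000) / (283 / 120000))
  have h := this.2 (by exact_mod_cast h4)
  omega

/-- `cellIdx` is monotone on the corner `(ν₀, 1 − 5ν₀)`. [folklore] -/
theorem cellIdx_mono_corner {s t : ℝ} (hst : s ≤ t) (ht' : t < 1 - 5 * (1651 / 10000 : ℝ)) :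
    cellIdx s ≤ cellIdx t := by
  unfold cellIdx
  rw [if_pos (by linarith), if_pos (by linarith)]
  apply Nat.floor_le_floor
  apply div_le_div_of_nonneg_right _ (by norm_num)
  linarith

/-- In the corner the pair sum is below the band cut: `bandIdx = 0`. [folklore] -/
theorem bandIdx_corner {s t : ℝ} (hs : s < 1 - 5 * (1651 / 10000 : ℝ)) (ht : t < 1 - 5 * (1651 / 10000 : ℝ)) :
    bandIdx (s + t) = 0 := by
  unfold bandIdx; rw [if_pos (by linarith)]

/-! ### Conjuncts (ii), (iii) and the table facts for `coneCert` -/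

/-- Conjunct (ii): `coneCert(∅) = 1`. [cite: FordMaynard2024PrimeSieves, Theorem 7.3 (g(∅) = 1)] -/
theorem coneCert_empty (e : Fin 0 → ℝ) : coneCert 0 e = 1 := by
  show gTab 0 e + gFace 0 e = 1
  have h1 : gTab 0 e = 1 := rfl
  have h2 : gFace 0 e = 0 := by unfold gFace; rw [if_neg (by omega)]
  rw [h1, h2, add_zero]

/-- `t ∈ openSmall ⇒ ν₀ < t`. [folklore] -/
theorem lower_of_mem_openSmall {t : ℝ} (h : t ∈ openSmall) : (1651 / 10000 : ℝ) < t := h.1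

/-- Conjunct (iii), the CLOSED support clause: for monotone `y`, `coneCert r y ≠ 0 ⇒ r = 0 ∨ (yᵢ > ν₀ ∀ i ∧ |y| ≤ 1/2)`.
[cite: FordMaynard2024PrimeSieves, (7.1) (𝒢₁ = {|x| + ψ(x) ≤ γ}, ψ ≡ 0 here)] -/
theorem coneCert_support (r : ℕ) (y : Fin r → ℝ) (_hy : Monotone y) (h : coneCert r y ≠ 0) :
    r = 0 ∨ ((∀ i, (1651 / 10000 : ℝ) < y i) ∧ ∑ i, y i ≤ 1 / 2) := by
  by_cases hF : gFace r y ≠ 0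
  · unfold gFace at hF
    split_ifs at hF with hc
    · exact Or.inr ⟨hc.2.2.2.1, hc.2.2.2.2⟩
    · exact absurd rfl hF
  · push Not at hF
    have hT : gTab r y ≠ 0 := by
      intro h0; apply h; show gTab r y + gFace r y = 0; rw [h0, hF, add_zero]
    match r, y, hT with
    | 0, _, _ => exact Or.inl rfl
    | 1, y, hT =>
        right
        have hc : (1651 / 10000 : ℝ) < y 0 ∧ y 0 ≤ 1 / 2 := by
          by_contra hc; exact hT (by show (if _ then _ else _ : ℝ) = 0; rw [if_neg hc])
        refine ⟨fun i => ?_, ?_⟩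
        · have : i = 0 := Subsingleton.elim _ _
          subst this; exact hc.1
        · rw [Fin.sum_univ_one]; exact hc.2
    | 2, y, hT =>
        right
        have hc : y 0 ≤ y 1 ∧ y 0 ∈ openSmall ∧ y 1 ∈ openSmall ∧ y 0 + y 1 ≠ 8349 / 20000 ∧
            y 0 + y 1 < 1 / 2 := by
          by_contra hc; exact hT (by show (if _ then _ else _ : ℝ) = 0; rw [if_neg hc])
        refine ⟨fun i => ?_, ?_⟩
        · fin_cases i
          · exact lower_of_mem_openSmall hc.2.1
          · exact lower_of_mem_openSmall hc.2.2.1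
        · rw [Fin.sum_univ_two]; linarith [hc.2.2.2.2]
    | 3, y, hT =>
        right
        have hc : Monotone y ∧ (∀ i, y i ∈ openSmall) ∧ ∑ i, y i < 1 / 2 := by
          by_contra hc; exact hT (by show (if _ then _ else _ : ℝ) = 0; rw [if_neg hc])
        exact ⟨fun i => lower_of_mem_openSmall (hc.2.1 i), hc.2.2.le⟩
    | n + 4, _, hT => exact absurd rfl hT

/-- Table fact for `k = 2, 3, 6`: `coneCert₁ ≤ −1` on `(ν₀, 1/2]`. [folklore] -/
theorem coneCert_one_le (y : Fin 1 → ℝ) (h1 : (1651 / 10000 : ℝ) < y 0) (h2 : y 0 ≤ 1 / 2) :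
    coneCert 1 y ≤ -1 := by
  show gTab 1 y + gFace 1 y ≤ -1
  have hT : gTab 1 y = -1 := by show (if _ then _ else _ : ℝ) = -1; rw [if_pos ⟨h1, h2⟩]
  have := gFace_nonpos 1 y
  linarith

/-- Table fact for `k = 3`: `coneCert₂ ≤ 1` (indeed `≤ 0.999999`). [folklore] -/
theorem coneCert_two_le_one (y : Fin 2 → ℝ) : coneCert 2 y ≤ 1 := by
  show gTab 2 y + gFace 2 y ≤ 1
  have h1 := gTab_two_le y
  have h2 := gFace_nonpos 2 y
  linarith

/-- Table fact for `k = 6`: `coneCert₂ ≤ −0.307737` on monotone pairs in `(ν₀, 1 − 5ν₀)²` (open cells: the corner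
entries of the table; otherwise a face, value `≤ −64`). [folklore] -/
theorem coneCert_two_corner_le (y : Fin 2 → ℝ) (hy : Monotone y) (hbox : ∀ i, (1651 / 10000 : ℝ) < y i)
    (hlt : ∀ i, y i < 1 - 5 * (1651 / 10000 : ℝ)) : coneCert 2 y ≤ -(307737 / 1000000) := by
  show gTab 2 y + gFace 2 y ≤ -(307737 / 1000000)
  have h01 : y 0 ≤ y 1 := hy (by decide)
  have hsum : y 0 + y 1 < 1 / 2 := by linarith [hlt 0, hlt 1]
  have hband : y 0 + y 1 ≠ 8349 / 20000 := by linarith [hlt 0, hlt 1]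
  by_cases hopen : y 0 ∈ openSmall ∧ y 1 ∈ openSmall
  · -- generic corner point: the table entry
    have hT : gTab 2 y = (g2Lookup (cellIdx (y 0)) (cellIdx (y 1)) (bandIdx (y 0 + y 1)) : ℝ) / 1000000 := by
      show (if _ then _ else _ : ℝ) = _; rw [if_pos ⟨h01, hopen.1, hopen.2, hband, hsum⟩]
    have ha := cellIdx_le_three (hbox 0) (hlt 0)
    have hb := cellIdx_le_three (hbox 1) (hlt 1)
    have hab := cellIdx_mono_corner h01 (hlt 1)
    have hj := bandIdx_corner (hlt 0) (hlt 1)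
    have hv := g2Lookup_corner_le _ ha _ hb hab
    rw [hj] at hT
    have hv' : (g2Lookup (cellIdx (y 0)) (cellIdx (y 1)) 0 : ℝ) ≤ -307737 := by exact_mod_cast hv
    have hF := gFace_nonpos 2 y
    rw [hT]; linarith
  · -- a coordinate on a grid edge: the face penalty fires
    have hT : gTab 2 y = 0 := by
      show (if _ then _ else _ : ℝ) = 0
      rw [if_neg (by rintro ⟨-, h0, h1, -⟩; exact hopen ⟨h0, h1⟩)]
    have hedge : ∃ i, y i ∈ edgeSet := by
      by_contra hne
      push Not at hne
      apply hopen
      refine ⟨⟨hbox 0, by linarith [hlt 0], ?_⟩, ⟨hbox 1, by linarith [hlt 1], ?_⟩⟩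
      · exact fun h => (hne 0) h
      · exact fun h => (hne 1) h
    have hF : gFace 2 y ≤ -64 :=
      gFace_le_of_edge (by norm_num) (by norm_num) hy hbox (by rw [Fin.sum_univ_two]; linarith) hedge
    rw [hT]; linarith

/-- Table fact for `k = 6`: `coneCert₃ ≤ 0.941613` on monotone box triples with `|y| < 1/2`. [folklore] -/
theorem coneCert_three_le (y : Fin 3 → ℝ) : coneCert 3 y ≤ 941613 / 1000000 := by
  show gTab 3 y + gFace 3 y ≤ _
  have h1 := gTab_three_le y
  have h2 := gFace_nonpos 3 y
  linarith

/-- Table fact for `k = 6`: `coneCert₃ ≤ 0` when `|y| = 1/2` (no open piece; at most the face penalty). [folklore] -/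
theorem coneCert_three_half (y : Fin 3 → ℝ) (h : ∑ i, y i = 1 / 2) : coneCert 3 y ≤ 0 := by
  show gTab 3 y + gFace 3 y ≤ 0
  have hT : gTab 3 y = 0 := by
    show (if _ then _ else _ : ℝ) = 0
    rw [if_neg (by rintro ⟨-, -, hlt⟩; linarith)]
  have h2 := gFace_nonpos 3 y
  linarith

/-! ### Conjunct (iv) for `coneCert`, modulo its dimensions 4 and 5 -/

/-- **Conjunct (iv) of `stub_coneCertClosed` for the witness `coneCert`, from its `k = 4` and `k = 5` instances alone**:
dimensions `2, 3, 6` are discharged by the table facts above through `signClause_01651_of_parts`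
(`q = 0.307737`, `p = 0.941613`, `−5 − 15q + 10p = −0.199815 ≤ 0`).  The two hypotheses are the certifier's (H1)
on the `55 225` (k = 4) and `86 966` (k = 5) open types — the residual finite check of the sign clause.
[cite: FordMaynard2024PrimeSieves, Theorem 7.3 (a) (sign hypothesis on ℋ(P)), §8.2] -/
theorem coneCert_signClause_of_four_five
    (h4 : ∀ x : Fin 4 → ℝ, Monotone x → (∀ i, (1651 / 10000 : ℝ) < x i ∧ x i < 1 - 1651 / 10000) →
      ∑ i, x i = 1 → starSum coneCert 4 x ≤ 0)
    (h5 : ∀ x : Fin 5 → ℝ, Monotone x → (∀ i, (1651 / 10000 : ℝ) < x i ∧ x i < 1 - 1651 / 10000) →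
      ∑ i, x i = 1 → starSum coneCert 5 x ≤ 0) :
    ∀ k : ℕ, 2 ≤ k → k ≤ 6 → ∀ x : Fin k → ℝ, Monotone x →
      (∀ i, (1651 / 10000 : ℝ) < x i ∧ x i < 1 - 1651 / 10000) → ∑ i, x i = 1 → starSum coneCert k x ≤ 0 :=
  signClause_01651_of_parts (q := 307737 / 1000000) (p := 941613 / 1000000) coneCert_support coneCert_empty
    (fun y h1 h2 => coneCert_one_le y h1 h2)
    (fun y _ _ _ => coneCert_two_le_one y)
    (fun y hy hb hl => coneCert_two_corner_le y hy hb hl)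
    (fun y _ _ _ => coneCert_three_le y)
    (fun y _ _ h => coneCert_three_half y h)
    (by norm_num) (by norm_num) h4 h5

end Summit.Parity.GeneralizedHardyLittlewood.FordMaynardSieveConst01651SieveConst01651

end
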